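import Literature.Computability.AlgebraicComplexity.GroupTheoreticMatMul

/-!
# ω-census TOOL law: ORBIT FAMILIES for the simultaneous triple product property (stpp-3 gen 16)

HONEST FRAMING (pub-omega census; verbatim): lottery ticket; floor = certified bounds/negative ranges.
Census STRUCTURE bookkeeping (question Q7 of the pub-omega cell), not progress on `ω`: an STPP family of 2-subsets certifies no
matrix-multiplication bound of interest.  This file records, in the kernel, the CRITERION behind the seat's 'orbit method'
(hub, 2026-08-26; first find: `(2,2,2)⁸ ⊆ ℤ/4 × ℤ/7 × ℤ/7` over a quaternion subgroup of `Aut`, kernel witness in `STPP222Pow8SeedsK`).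

**Orbit criterion.**  Let `e : Fin N → (H ≃+ H)` enumerate, injectively, a finite set of additive automorphisms of an abelian group
`H` that contains the identity (`e i₀ = 1`, stated pointwise) and is closed under `(κ, κ') ↦ κ⁻¹ ∘ κ'` (so it is a subgroup `K ≤ Aut H` of order `N`), and let
`A, B, C ⊆ H` be ONE base triple.  If `(A, B, C)` has the (additive) triple product property and
`(x′ − y) + e m (y′ − z) + e n (z′ − x) ≠ 0` for all `x, x′ ∈ A`, `y, y′ ∈ B`, `z, z′ ∈ C` and all index pairs `(m, n) ≠ (i₀, i₀)`,
then the ORBIT FAMILY `i ↦ (e i '' A, e i '' B, e i '' C)` has the simultaneous TPP of Cohn–Kleinberg–Szegedy–Umans (tree form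
`IsSTPP`).  Proof: the word of the index triple `(i, j, k)` is `e i` applied to `(x′ − y) + λ (y′ − z) + μ (z′ − x)` with
`λ = (e i)⁻¹ ∘ e j`, `μ = (e i)⁻¹ ∘ e k`; if `(λ, μ) ≠ (1, 1)` the hypothesis forbids a zero, otherwise `j = i`, `k = i` by injectivity and the
word is the TPP word of the base triple.  The point of the criterion is arithmetic: `N² · |A−B| · |B−C| · |C−A|` sums decide a family whose
literal check has `N³ · 64` words, and the search for a base triple runs over a handful of group elements — which is how the hub found
families where annealing stalled.  No claim beyond the implication is made (in particular nothing about which `K` admit base triples).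

References: H. Cohn, R. Kleinberg, B. Szegedy, C. Umans, FOCS 2005 (arXiv:math/0511460), Def. 5.1.  Seat pub-omega-stpp-3 (gen 16), 2026-08-26;
records HOME `pub-omega-stpp-3-g16/results/hub-finds/orbit-method/` (complete-search implementation `orb222.c` of the same criterion).
-/

open Literature.Computability.AlgebraicComplexity Finset

namespace Summit.MatrixMultiplication.OmegaCensus

namespace OrbitFamily

/-- **Orbit criterion for the simultaneous TPP** (census TOOL law).  `e` enumerates injectively a set of additive automorphisms
containing the identity `e i₀` and closed under `κ⁻¹ ∘ κ'` (`hcl`) — all three stated POINTWISE so that concrete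
instances are decidable —; `htpp` is the additive triple product property of the base triple
`(A, B, C)`; `horb` is the orbit condition for every index pair other than `(i₀, i₀)`.  Conclusion: the family of images
`(e i '' A, e i '' B, e i '' C)` satisfies `IsSTPP`. [cite: CohnKleinbergSzegedyUmans2005, Def. 5.1] -/
theorem isSTPP_image {H : Type*} [AddCommGroup H] [DecidableEq H] {N : ℕ}
    (e : Fin N → H ≃+ H) (i₀ : Fin N) (he₀ : ∀ w, e i₀ w = w) (hinj : ∀ i j : Fin N, (∀ w, e i w = e j w) → i = j)
    (hcl : ∀ i j : Fin N, ∃ m : Fin N, ∀ w, (e i).symm (e j w) = e m w)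
    (A B C : Finset H)
    (htpp : ∀ x ∈ A, ∀ x' ∈ A, ∀ y ∈ B, ∀ y' ∈ B, ∀ z ∈ C, ∀ z' ∈ C,
      (x' - x) + (y' - y) + (z' - z) = 0 → x = x' ∧ y = y' ∧ z = z')
    (horb : ∀ m n : Fin N, ¬ (m = i₀ ∧ n = i₀) → ∀ x ∈ A, ∀ x' ∈ A, ∀ y ∈ B, ∀ y' ∈ B, ∀ z ∈ C, ∀ z' ∈ C,
      (x' - y) + e m (y' - z) + e n (z' - x) ≠ 0) :
    IsSTPP (fun i => A.image (e i)) (fun i => B.image (e i)) (fun i => C.image (e i)) := by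
  intro i j k s hs s' hs' t ht t' ht' u hu u' hu' hsum
  simp only [Finset.mem_image] at hs hs' ht ht' hu hu'
  obtain ⟨x, hx, rfl⟩ := hs
  obtain ⟨x', hx', rfl⟩ := hs'
  obtain ⟨y, hy, rfl⟩ := ht
  obtain ⟨y', hy', rfl⟩ := ht'
  obtain ⟨z, hz, rfl⟩ := hu
  obtain ⟨z', hz', rfl⟩ := hu'
  obtain ⟨m, hm⟩ := hcl i j
  obtain ⟨n, hn⟩ := hcl i k
  have hii : ∀ w, (e i).symm (e i w) = w := fun w => (e i).symm_apply_apply w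
  -- pull the word back along `e i`
  have h2 : (e i).symm ((e i x' - e k x) + (e j y' - e i y) + (e k z' - e j z)) = 0 := by
    rw [hsum, map_zero]
  simp only [map_add, map_sub, hii, hm, hn] at h2
  have key : (x' - y) + e m (y' - z) + e n (z' - x) = 0 := by
    calc (x' - y) + e m (y' - z) + e n (z' - x)
        = (x' - e n x) + (e m y' - y) + (e n z' - e m z) := by simp only [map_sub]; abel
      _ = 0 := h2
  by_cases hmn : m = i₀ ∧ n = i₀
  · obtain ⟨hm0, hn0⟩ := hmn
    subst hm0; subst hn0
    -- `e j = e i` and `e k = e i`, hence `j = i`, `k = i`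
    have hji : j = i := by
      refine hinj j i fun w => ?_
      have h := hm w
      rw [he₀, AddEquiv.symm_apply_eq] at h
      exact h
    have hki : k = i := by
      refine hinj k i fun w => ?_
      have h := hn w
      rw [he₀, AddEquiv.symm_apply_eq] at h
      exact h
    subst hji; subst hki
    rw [he₀, he₀] at key
    have key' : (x' - x) + (y' - y) + (z' - z) = 0 := by
      calc (x' - x) + (y' - y) + (z' - z) = (x' - y) + (y' - z) + (z' - x) := by abel
        _ = 0 := key
    obtain ⟨rfl, rfl, rfl⟩ := htpp x hx x' hx' y hy y' hy' z hz z' hz' key'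
    exact ⟨rfl, rfl, rfl, rfl, rfl⟩
  · exact absurd key (horb m n hmn x hx x' hx' y hy y' hy' z hz z' hz')

/-- Packaged form for the census statements: an orbit family of a base triple of `2`-subsets is a `(2,2,2)^N` witness
(images under automorphisms keep cardinality `2`). [cite: CohnKleinbergSzegedyUmans2005, Def. 5.1] -/
theorem exists_isSTPP_222pow {H : Type*} [AddCommGroup H] [DecidableEq H] {N : ℕ}
    (e : Fin N → H ≃+ H) (i₀ : Fin N) (he₀ : ∀ w, e i₀ w = w) (hinj : ∀ i j : Fin N, (∀ w, e i w = e j w) → i = j)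
    (hcl : ∀ i j : Fin N, ∃ m : Fin N, ∀ w, (e i).symm (e j w) = e m w)
    (A B C : Finset H) (hA : A.card = 2) (hB : B.card = 2) (hC : C.card = 2)
    (htpp : ∀ x ∈ A, ∀ x' ∈ A, ∀ y ∈ B, ∀ y' ∈ B, ∀ z ∈ C, ∀ z' ∈ C,
      (x' - x) + (y' - y) + (z' - z) = 0 → x = x' ∧ y = y' ∧ z = z')
    (horb : ∀ m n : Fin N, ¬ (m = i₀ ∧ n = i₀) → ∀ x ∈ A, ∀ x' ∈ A, ∀ y ∈ B, ∀ y' ∈ B, ∀ z ∈ C, ∀ z' ∈ C,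
      (x' - y) + e m (y' - z) + e n (z' - x) ≠ 0) :
    ∃ A' B' C' : Fin N → Finset H, IsSTPP A' B' C' ∧ ∀ i, (A' i).card = 2 ∧ (B' i).card = 2 ∧ (C' i).card = 2 :=
  ⟨_, _, _, isSTPP_image e i₀ he₀ hinj hcl A B C htpp horb, fun i =>
    ⟨(Finset.card_image_of_injective A (e i).injective).trans hA,
     (Finset.card_image_of_injective B (e i).injective).trans hB,
     (Finset.card_image_of_injective C (e i).injective).trans hC⟩⟩

end OrbitFamily

end Summit.MatrixMultiplication.OmegaCensus
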